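import Summits.FinalStateConjecture.FinalStateConjecture.Theses.BartnikGapSettling
import Summits.FinalStateConjecture.FinalStateConjecture.Theorems.BartnikGapSettlingBondiBartnikRigidityTrivialRegime
import Literature.Geometry.Lorentzian.BondiBartnikGap
import Literature.Geometry.Lorentzian.CausalFutureProofs
import Literature.Geometry.Lorentzian.DeviationTolerance

/-!
# Line `two-cones-one-sphere` — checked skeleton for crux `BondiBartnikRigidity`
# (stmt-FinalStateConjecture-10807, route `BartnikGapSettling`), built UNDER THE REPAIRED TARGET C′

planner-cruxplan-stmt-FinalStateConjecture-10807-two-cones-one-sphere-0 · 2026-08-16 · crux-plan, round 1.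

## Status of the target (why `…_of` concludes C′ and not the route decl)

The route decl `…Theses.BartnikGapSettling.BondiBartnikRigidity` (Theses file rev 2, unchanged) is
MIS-STATED: two independent line leads (`Lines/Sketch-dead.md`, `Lines/Sketch-dead-c1.md`, item note
`verdict: misstated` 2026-08-16T12:57Z) and the whole triage panel (TRIAGE-r1-1/2/3) agree that

* (Defect A) for `Λ > ‖η‖ₑ = 1` the flat-chart clause of `IsNearKerrLeaf k' Λ …` is met by COLLAPSED
  charts (formal anchor: `Literature/Geometry/Lorentzian/DeviationTolerance.lean`,
  `Spacetime.deviationCk_hypBackground_top_le`, p107413/p107768), and with such a junk hypothesis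
  leaf the `N = 0` sector of the filed text is FALSE on paper at `Λ = 2` (zero-cost high-frequency
  swarm W2, Sketch-dead-c1 §2.3) — no Kerr-collar minimality needed;
* (Defect B) seamed cores (`N ≥ 2`, or `N = 1` with `p` off the collar) carry no
  `RoundSectionFamily`, so those sectors are VACUOUS (tree instance
  `Minkowski.not_hasCutBondiMass_kissingBalls`).

Hence NO honest stub set composes to the filed decl: any composition must serve `Λ ≥ 1 ∧ N = 0`,
where the statement is false (crux `NOTES.md` item 3: "do not plan lines for the filed text").
Exactly as the sibling crux 10809 was handled (Lines/deficit_ratchet.lean, hair_vacates_the_margin.lean: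
checked skeletons against the restatement C″, the lead registering with `--crux-decl`), this file
targets the REPAIRED statement C′ = `BondiBartnikRigidityRepaired` of `Lines/SketchRepairedStatement.lean`
(lead c1, minimal repair (b): `Λ < 1`, `N ≤ 1`, `N = 0 ∨ p ∈ some collar slab`; everything else
byte-identical to the filed term), INLINED VERBATIM in §0 because `Cruxes/` modules are not built on
the farm, together with `filed_le_repaired : BondiBartnikRigidity ≤ BondiBartnikRigidityRepaired`
(c1's `repaired_of_filed`; `≤` on `Prop` is implication), so the target is formally a weakening of the
crux. When the tenure planner files the repaired item the composition ports verbatim; if the BG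
variant (a) (`IsNearKerrLeafBG`, `∀ Λ < ⊤`) is filed instead, only the three leaf-consuming stubs
(`stub_conePinning`, `stub_farLeafCompletion`, `stub_probeConeStability`) change their leaf
hypothesis; if c3's own-energy form
(`Cruxes/GapExhaustion/RESTATED_c3.lean`, `BondiBartnikRigidityRestated`) is filed, the two
competitor stubs become idle and the floor stub is c3's `KerrCollarMinimality` in own-energy form —
but NOTE for tenure: that text keeps `∀ Λ < ⊤` without a bounded-geometry clause and therefore
inherits Defect A / W2 in its `N = 0` sector.

## The line (idea card `Ideas/two-cones-one-sphere.md`, sharpened by TRIAGE-r1-1/2/3)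

TWO CONES FROM ONE SPHERE. For `N = 1` with the probe point in the collar, the core IS the thick
collar `C = Φ({t* = 0, M < r ≤ 3M})` and its cut of `𝓘⁺` is generated by ONE outgoing null
hypersurface `𝒩_𝒟 = ∂J⁺(C) ∖ C` emanating from the collar-edge sphere `Σ = Φ({t* = 0, r = 3M})`
(untrapped, outside the ergoregion `r_E ≤ 2M`, crease-free to `𝓘⁺` in exact Kerr for all
`|a| < M`: triage T2/E3). The `δ`-Kerr collar pins the `k'`-jet of the metric at `Σ`, so Kerr's own
cone `𝒩_K` from the SAME sphere jet is the comparison object, and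

  gap ≤ γ  ⟹ (ONE glued Kerr-capped competitor, `stub_kerrCappedCompetitor`)  own cut energy ≤ M + γ + ϵ
           ⟹ (Hawking-flux identity along 𝒩_𝒟 vs 𝒩_K from the shared sphere jet)
             0 ≤ ∫_{𝒩_𝒟} Φ ≤ Flux_K(M, a; 3M) + slack,   Flux_K = M − m_H^{Kerr}(Σ) (= 0 iff a = 0),

a scalar sandwich on one cone. Kerr's cone MINIMISES the flux from the sphere jet
(`stub_kerrCollarFloor` = Kerr-collar minimality in own-energy form, the calibration) and does so
COERCIVELY (second variation = canonical-energy flux of linearised gravity through `𝒩 ⊂ {r ≥ 3M}`,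
where `T = ∂_{t*}` is timelike): near-equality pins `𝒟`'s cone data near Kerr's, and FINITE-TIME
Cauchy(collar)–characteristic(cone) stability — legal because `ε` is fixed before `(δ, γ)` — turns
that into an `ε₁`-Kerr chart on the WEDGE `J⁺(C) ∩ {t* < T + 1, r ≤ R}` (`stub_conePinning`, the
heart). The far zone of the concluding leaf is then built hyperboloidally inside `J⁺(C)`
(`stub_farLeafCompletion`): incoming content is priced by ENERGY (the far flux of `𝒩_𝒟` over Kerr's
far cone, which the wedge pins) and by FREQUENCY (the honest `(Λ, k')`-leaf, `Λ < 1`, `k' ≥ k + 2`: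
Sketch-dead-c1 §2.3), escaping content is irrelevant (it lies to the past of the leaf). The `N = 0`
sector (probe point, no collar) is the light-cone / hyperboloidal positive-mass STABILITY statement
`stub_probeConeStability` fed by the small-ball competitor `stub_probeBartnikMassZero` (β_B({p}) = 0; shared verbatim with line
hyperboloidal-mass-pinches-flat);
`N ≥ 2` does not occur under C′; `Λ ≤ ε` is the landed trivial regime (p103152).

## Contents

§0 target C′ (verbatim) + `filed_le_repaired`; §1 the six registered stub statements; §2 the
compositions — `collarSectorGap_of_stubs` (INTERLOCK with line hyperboloidal-mass-pinches-flat, whose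
foreign `stub_collarSectorGap` it proves from stubs 2–5), `probeConeStability_of_hyperboloidalLine`
(stub 6 from that line's F3 + B2) and `BondiBartnikRigidityRepaired_of` (pure logic, sorry-free).

Disproof used: none exists for this crux (payload `disproof_path` absent on this hub; no
`Disproof.lean` among the crux workfiles) — nothing to honour or cite; the standing negative
knowledge used instead is Defect A/B above (no stub quantifies `Λ ≥ 1`; no stub speaks about a
seamed core: every collared stub carries `∃ i, p ∈ Φ i '' slab`).
-/

noncomputable section

-- D-0017: single-problem summit, `Summit.<S>.<S>.…` by design (cf. lakefile `weak.linter.dupNamespace`).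
set_option linter.dupNamespace false

open Set Filter Function Topology TopologicalSpace
open Literature.Geometry.Lorentzian
open scoped Manifold ContDiff Topology ENNReal BigOperators

namespace Summit.FinalStateConjecture.FinalStateConjecture.Cruxes.BondiBartnikRigidity.TwoConesOneSphere

/-! ## §0 The target: the repaired crux C′ (verbatim `Lines/SketchRepairedStatement.lean`, lead c1) -/

/-- **Repaired crux C′** — BYTE-IDENTICAL copy of
`Summit.FinalStateConjecture.FinalStateConjecture.Cruxes.BondiBartnikRigidity.BondiBartnikRigidityRepaired`
(`Cruxes/BondiBartnikRigidity/Lines/SketchRepairedStatement.lean`, lead c1, rev 2, lean check rc 0):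
the filed `BondiBartnikRigidity` with (1) `∀ Λ, Λ < 1 →` for `Λ < ⊤` (Defect A), (2) `N ≤ 1`
(Defect B/C), (3) `N = 0 ∨ ∃ i, p ∈ Φ i '' (collar slab i)` (Defect B); everything else is the filed
term. Inlined because `Cruxes/` modules are not built on the farm. -/
def BondiBartnikRigidityRepaired : Prop :=
  open Literature.Geometry.Lorentzian in ∀ (χ m₀ : ℝ) (N₀ k : ℕ) (ε : ENNReal), χ < 1 → 0 < m₀ → 0 < ε → ∃ k' : ℕ, ∀ Λ : ENNReal, Λ < 1 → ∃ (δ : ENNReal) (γ : ℝ), 0 < δ ∧ 0 < γ ∧ ∀ (X : Type) [TopologicalSpace X] [ChartedSpace E3 X] [IsManifold (𝓡 3) ((⊤ : ℕ∞) : WithTop ℕ∞) X] [T2Space X] [SecondCountableTopology X] [ConnectedSpace X], ∀ D ∈ admissibleVacuumData X, ∀ (𝒟 : VacuumCauchyDevelopment D) (N : ℕ) (M a : Fin N → ℝ) (S : Set 𝒟.carrier) (p : 𝒟.carrier) (mo' : Fin N → lorentzGroup × E4) (B' : Fin N → ModelBackground) (Φ : ∀ i, (B' i).domain → 𝒟.carrier),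 𝒟.IsMaximal → N ≤ N₀ → N ≤ 1 → (∀ i, m₀ ≤ M i ∧ M i ≤ m₀⁻¹ ∧ |a i| ≤ χ * M i) → 𝒟.toCauchyDevelopment.IsNearKerrLeaf k' Λ N M a S → p ∈ S → (N = 0 ∨ ∃ i, p ∈ Φ i '' (B' i).truncTimeSlab (3 * M i) 0) → (∀ i, B' i = starBackground (mo' i).1 (mo' i).2 (M i) (a i) (fun x => Kerr.radius (a i) (poincareInv (mo' i).1 (mo' i).2 x))) → (∀ i, ContMDiffOn 𝓘(ℝ, E4) (𝓡 4) ((⊤ : ℕ∞) : WithTop ℕ∞) (Φ i) {x | -1 < (B' i).time x.1 ∧ (B' i).time x.1 < 1 ∧ (B' i).radius x.1 < 3 * M i + 1} ∧ Topology.IsOpenEmbedding ({x | -1 < (B' i).time x.1 ∧ (B' i).time x.1 < 1 ∧ (B' i).radius x.1 < 3 * M i + 1}.restrict (Φ i))) → (∀ i, 𝒟.toSpacetime.truncDeviationCk (B' i) (Φ i) k' (3 * M i) 0 ≤ δ) → (∀ i, Φ i '' (B' i).truncTimeSlab (3 * M i) 0 ⊆ S) → Pairwise (Function.onFun Disjoint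 fun i => Φ i '' (B' i).truncTimeSlab (3 * M i) 0) → (∃ m : ℝ, 𝒟.toCauchyDevelopment.HasCutBondiMass ({p} ∪ ⋃ i, Φ i '' (B' i).truncTimeSlab (3 * M i) 0) m) → (∀ (X' : Type) [TopologicalSpace X'] [ChartedSpace E3 X'] [IsManifold (𝓡 3) ((⊤ : ℕ∞) : WithTop ℕ∞) X'] [T2Space X'] [SecondCountableTopology X'] [ConnectedSpace X'], ∀ D' ∈ admissibleVacuumData X', ∀ (𝒟' : VacuumCauchyDevelopment D') (U : Set 𝒟.carrier) (φ : 𝒟.carrier → 𝒟'.carrier) (m' : ℝ), 𝒟'.IsMaximal → IsOpen U → ({p} ∪ ⋃ i, Φ i '' (B' i).truncTimeSlab (3 * M i) 0) ⊆ U → ContMDiffOn (𝓡 4) (𝓡 4) ((⊤ : ℕ∞) : WithTop ℕ∞) φ U → Topology.IsOpenEmbedding (U.restrict φ) → (∀ q ∈ U, pullbackBilin (I := 𝓡 4) (I' := 𝓡 4) φ 𝒟'.metric.val q = 𝒟.metric.val q) → (∀ q ∈ U, 𝒟'.timeOrientation.IsFutureDirected (mfderiv (𝓡 4) (𝓡 4)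 φ q (𝒟.timeOrientation.vectorField q))) → 𝒟'.toCauchyDevelopment.HasCutBondiMass (φ '' ({p} ∪ ⋃ i, Φ i '' (B' i).truncTimeSlab (3 * M i) 0)) m' → ∀ η : ℝ, 0 < η → ∃ m : ℝ, 𝒟.toCauchyDevelopment.HasCutBondiMass ({p} ∪ ⋃ i, Φ i '' (B' i).truncTimeSlab (3 * M i) 0) m ∧ m ≤ m' + γ + η) → ∃ S' : Set 𝒟.carrier, 𝒟.toCauchyDevelopment.IsNearKerrLeaf k ε N M a S' ∧ S' ⊆ 𝒟.metric.causalFuture 𝒟.timeOrientation S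


/-- **C′ is a WEAKENING of the filed crux** (c1's `repaired_of_filed`, reproduced for THIS copy of the
text): the repair only adds hypotheses and shrinks the range of `Λ`, so a proof of the filed decl would
close this target, and this skeleton proves nothing about the filed decl. Stated with `≤` on `Prop`
(definitionally the implication `BondiBartnikRigidity → BondiBartnikRigidityRepaired`; use it as
`filed_le_repaired h`) so that the skeleton audit's candidate theorem — the one concluding the target
by name — is unambiguously `BondiBartnikRigidityRepaired_of`. -/
theorem filed_le_repaired :
    Summit.FinalStateConjecture.FinalStateConjecture.Theses.BartnikGapSettling.BondiBartnikRigidity ≤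
      BondiBartnikRigidityRepaired := by
  intro h χ m₀ N₀ k ε hχ hm₀ hε
  obtain ⟨k', hk'⟩ := h χ m₀ N₀ k ε hχ hm₀ hε
  refine ⟨k', fun Λ hΛ => ?_⟩
  obtain ⟨δ, γ, hδ, hγ, H⟩ := hk' Λ (hΛ.trans_le le_top)
  refine ⟨δ, γ, hδ, hγ, ?_⟩
  intro X _ _ _ _ _ _ D hD 𝒟 N M a S p mo' B' Φ hmax hN _hN1 hwin hleaf hp _hpc hB hΦ hdev hsub hdis hcut hgap
  exact H X D hD 𝒟 N M a S p mo' B' Φ hmax hN hwin hleaf hp hB hΦ hdev hsub hdis hcut hgap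

/-! ## §1 The stubs

Conventions. All six are stated over existing declarations only (`Theses.BartnikGapSettling`
vocabulary: `admissibleVacuumData`, `VacuumCauchyDevelopment`, `IsNearKerrLeaf`, `starBackground`,
`truncDeviationCk`, `truncTimeSlab`, `HasCutBondiMass`; `BondiBartnikGap.lean`: `IsCompetitorMass`;
`KerrConvergence.lean`: `supCkENorm`, `Spacetime.deviationExtend`). The collared stubs (`N = 1`) are
indexed by `Fin 1` exactly like the target so that the composition instantiates them verbatim; the
core is always written out as `{p} ∪ ⋃ i, Φ i '' (B' i).truncTimeSlab (3 * M i) 0` (= `collarCore`).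
No stub quantifies `Λ ≥ 1` (Defect A) and every collared stub carries `∃ i, p ∈ Φ i '' slab`
(Defect B), so none is an instance of the dead sectors. -/

/-- **Stub 1 — small-ball competitor (`N = 0`): `β_B({p}) = 0`.** In an MGHD of admissible data,
a point `p` to the causal future of the data hypersurface has, for every `η > 0`, a competitor mass
`≤ η` of the core `{p}`: zoom into a small spacelike disc through `p` (its data are `H²`-near-flat at
small scale; vacuum small-sphere Bartnik data have mass `O(r⁵)`, Wiygul doi:10.1007/s00220-017-3005-8),
extend it to complete asymptotically flat vacuum data of ADM mass `≤ η` (Czimek, arXiv:1609.08814,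
small-data extension of the constraints; Corvino–Schoen far field), take its MGHD
(Christodoulou–Klainerman small-data spacetime: complete `𝓘⁺`, regular point cones with round
receding families, Bondi energy `≤` ADM mass `≤ η`, CK 1993 Ch. 17); it receives `int D(disc) ∋ p`
isometrically (`IsCompetitor.restrict`). SHARED VERBATIM — name and signature — with line
`hyperboloidal-mass-pinches-flat` (`stub_probeBartnikMassZero`, card B1 `ProbeBartnikMassZero`;
= core-cone S2): one landed theorem serves both lines. Size L. -/
theorem stub_probeBartnikMassZero :
    ∀ (X : Type) [TopologicalSpace X] [ChartedSpace E3 X] [IsManifold (𝓡 3) ∞ X]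
      [T2Space X] [SecondCountableTopology X] [ConnectedSpace X],
    ∀ D ∈ admissibleVacuumData X, ∀ (𝒟 : VacuumCauchyDevelopment D) (p : 𝒟.carrier),
    𝒟.IsMaximal → p ∈ 𝒟.metric.causalFuture 𝒟.timeOrientation (range 𝒟.embed) →
    ∀ η : ℝ, 0 < η → ∃ m' : ℝ, 𝒟.IsCompetitorMass ({p} : Set 𝒟.carrier) m' ∧ m' ≤ η := by
  sorry

/-- **Stub 2 — ONE glued Kerr-capped competitor (`N = 1`, card A1 `KerrCappedCompetitorBound` in
`ϵ`–`δ` form, triage-sharpened).** For a margin `χ < 1` and window `m₀` there is an order `k₂` such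
that for every `ϵ > 0` there is `δ₂ > 0` with: a thick collar chart `δ₂`-close in `C^{k₂}` to
Kerr`(M, a)`, `m₀ ≤ M ≤ m₀⁻¹`, `|a| ≤ χ M`, in an MGHD of admissible data, whose core is the collar
(probe point inside), has a competitor mass `≤ M + ϵ`. Construction (why plausibly true): by
continuity the data stay `2δ₂`-Kerr on an instance-dependent shell `3M ≤ r ≤ 3M + η`; the competitor
is the MGHD of the one-ended admissible data
`[𝒟's own Cauchy slice through the collar, inward part unchanged] ∪ [shell] ∪ [exact Kerr(M',a')
exterior]`, the transition made in the CONE PICTURE — characteristic gluing of the `2δ₂`-Kerr sphere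
data at `Σ_{3M+η/2}` to an exact Kerr`(M', a')` sphere along an outgoing null hypersurface of affine
length `~ M` (Aretakis–Czimek–Rodnianski Kerr characteristic gluing, doi:10.1007/s00220-023-04800-y;
Czimek–Rodnianski obstruction-free gluing arXiv:2210.09663; the 10 charges absorbed by
`(M', a', boost, translation)` with `|M' − M| ≤ C(χ, m₀) δ₂`), so NO thin-annulus penalty although the
agreement shell is thin (TRIAGE-r1-2 sharpen (2) / r1-3); local existence to the future of the glued
cone over a compact radius range (Rendall 1990; Luk arXiv:1107.0898) realises it as Cauchy data; the
image core's cone is exact Kerr's beyond the gluing radius, crease-free (triage T2/E3 with margin), so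
its rest-frame round family has Hawking limit `M'` (`HasCutBondiMass`, CK Ch. 17 in exact Kerr).
No leaf and no `Λ` enter. Size XL (a gluing theorem + Bondi bookkeeping in exact Kerr). -/
theorem stub_kerrCappedCompetitor : ∀ (χ m₀ : ℝ), χ < 1 → 0 < m₀ → ∃ k₂ : ℕ, ∀ ϵ : ℝ, 0 < ϵ →
    ∃ δ₂ : ℝ≥0∞, 0 < δ₂ ∧
    ∀ (X : Type) [TopologicalSpace X] [ChartedSpace E3 X] [IsManifold (𝓡 3) ∞ X]
      [T2Space X] [SecondCountableTopology X] [ConnectedSpace X],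
    ∀ D ∈ admissibleVacuumData X, ∀ (𝒟 : VacuumCauchyDevelopment D)
      (M a : Fin 1 → ℝ) (p : 𝒟.carrier) (mo' : Fin 1 → lorentzGroup × E4)
      (B' : Fin 1 → ModelBackground) (Φ : ∀ i, (B' i).domain → 𝒟.carrier),
    𝒟.IsMaximal → (∀ i, m₀ ≤ M i ∧ M i ≤ m₀⁻¹ ∧ |a i| ≤ χ * M i) →
    (∃ i, p ∈ Φ i '' (B' i).truncTimeSlab (3 * M i) 0) →
    (∀ i, B' i = starBackground (mo' i).1 (mo' i).2 (M i) (a i)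
      (fun x => Kerr.radius (a i) (poincareInv (mo' i).1 (mo' i).2 x))) →
    (∀ i, ContMDiffOn 𝓘(ℝ, E4) (𝓡 4) ∞ (Φ i)
        {x | -1 < (B' i).time x.1 ∧ (B' i).time x.1 < 1 ∧ (B' i).radius x.1 < 3 * M i + 1} ∧
      IsOpenEmbedding ({x | -1 < (B' i).time x.1 ∧ (B' i).time x.1 < 1 ∧
        (B' i).radius x.1 < 3 * M i + 1}.restrict (Φ i))) →
    (∀ i, 𝒟.toSpacetime.truncDeviationCk (B' i) (Φ i) k₂ (3 * M i) 0 ≤ δ₂) →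
    ∃ m' : ℝ, 𝒟.IsCompetitorMass ({p} ∪ ⋃ i, Φ i '' (B' i).truncTimeSlab (3 * M i) 0) m' ∧
      m' ≤ M 0 + ϵ := by
  sorry

/-- **Stub 3 — Kerr-collar floor (the calibration (KCM), own-energy form, `N = 1`).** For `χ < 1`,
`m₀ > 0` there is `k₃` such that for every `ϑ > 0` there is `δ₃ > 0` with: in an MGHD of admissible
data, EVERY cut Bondi energy of the core of a thick collar chart `δ₃`-close in `C^{k₃}` to
Kerr`(M, a)` (window, margin, probe point in the collar) is `≥ M − ϑ`. In the line's language: among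
vacuum developments of the thick Kerr collar, Kerr's own cone MINIMISES the Hawking flux from the
collar-edge sphere jet — `M_B(u_C) = m_H(Σ) + ∫_{𝒩} Φ ≥ M − o(1)`, with `m_H(Σ) = M − Flux_K` fixed by
the collar. For `a = 0` this is a null Penrose-type inequality from an UNTRAPPED round sphere with
`m_H = M` (in print only perturbatively: Alexakis arXiv:1506.06400; Roesch arXiv:1609.02875; Le
arXiv:2404.17137); for `a ≠ 0` it is the sign of the second variation of `M_B(u_C)` = canonical-energy
FLUX through `𝒩 ⊂ {r ≥ 3M}` (Hollands–Wald arXiv:1201.0463 indefiniteness lives in the ergoregion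
`r ≤ 2M`, inside the fixed collar; no printed negative T-flux on a T-timelike support, TRIAGE-r1-1 S2
sweep). NECESSARY for the crux (rattack ANALYSIS; REVIEW O1); = c3's `KerrCollarMinimality` read on
own energies; = the registered `stub_kerrCollarFloor` of line Sketch restricted to `p ∈ collar`
(the seamed `p ∉ collar` instances are Defect-B-vacuous and excluded). Cheapest falsifier: the
`{3M < r < 9M}`-supported canonical-energy sign scan (route CHEAPEST FALSIFIER; lead 0's kit
j017609/j017780, status unknown). Size: open problem. -/
theorem stub_kerrCollarFloor : ∀ (χ m₀ : ℝ), χ < 1 → 0 < m₀ → ∃ k₃ : ℕ, ∀ ϑ : ℝ, 0 < ϑ →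
    ∃ δ₃ : ℝ≥0∞, 0 < δ₃ ∧
    ∀ (X : Type) [TopologicalSpace X] [ChartedSpace E3 X] [IsManifold (𝓡 3) ∞ X]
      [T2Space X] [SecondCountableTopology X] [ConnectedSpace X],
    ∀ D ∈ admissibleVacuumData X, ∀ (𝒟 : VacuumCauchyDevelopment D)
      (M a : Fin 1 → ℝ) (p : 𝒟.carrier) (mo' : Fin 1 → lorentzGroup × E4)
      (B' : Fin 1 → ModelBackground) (Φ : ∀ i, (B' i).domain → 𝒟.carrier),
    𝒟.IsMaximal → (∀ i, m₀ ≤ M i ∧ M i ≤ m₀⁻¹ ∧ |a i| ≤ χ * M i) →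
    (∃ i, p ∈ Φ i '' (B' i).truncTimeSlab (3 * M i) 0) →
    (∀ i, B' i = starBackground (mo' i).1 (mo' i).2 (M i) (a i)
      (fun x => Kerr.radius (a i) (poincareInv (mo' i).1 (mo' i).2 x))) →
    (∀ i, ContMDiffOn 𝓘(ℝ, E4) (𝓡 4) ∞ (Φ i)
        {x | -1 < (B' i).time x.1 ∧ (B' i).time x.1 < 1 ∧ (B' i).radius x.1 < 3 * M i + 1} ∧
      IsOpenEmbedding ({x | -1 < (B' i).time x.1 ∧ (B' i).time x.1 < 1 ∧
        (B' i).radius x.1 < 3 * M i + 1}.restrict (Φ i))) →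
    (∀ i, 𝒟.toSpacetime.truncDeviationCk (B' i) (Φ i) k₃ (3 * M i) 0 ≤ δ₃) →
    ∀ m : ℝ, 𝒟.toCauchyDevelopment.HasCutBondiMass
      ({p} ∪ ⋃ i, Φ i '' (B' i).truncTimeSlab (3 * M i) 0) m → M 0 - ϑ ≤ m := by
  sorry

/-- **Stub 4 — cone pinning (`N = 1`; the heart: two cones from one sphere, coercively).** For
`χ < 1`, `m₀ > 0` and a near-zone radius `R` there is a Kerr-star time `T` (the stub's choice:
`T ≳ 7(R + 1)`, after the collar cone has swept `{r ≤ R + 1}`) such that for every chart target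
`(k₁, ε₁)` there is `k'` such that for every honest geometry bound `Λ < 1` there are `δ, γ, ϑ > 0`
with: if an MGHD of admissible data contains a `(Λ, k')`-near-Kerr leaf `S` with one windowed,
margined hole, a thick collar chart `Φ` (`δ`-close in `C^{k'}` to Kerr`(M, a)` on the slab, slab
`⊆ S`, probe point inside) whose core `C` has an own cut energy `≤ M + γ` and all cut energies
`≥ M − ϑ`, then the collar chart's slab map extends to a Kerr-star chart `Ψ` on the BIG LAYER
`{−1 < t* < T + 1, r < R + 1}` (same background, same motion) which is `ε₁`-close in `C^{k₁}` to
Kerr`(M, a)` on the WEDGE — the coordinate points of the truncated big layer whose image lies in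
`J⁺(C)` — and whose TOP LAYER `{T − 1 < t* < T + 1, r < R + 1}` is mapped into `J⁺(C)`.
Mechanism: (i) flux sandwich `0 ≤ ∫_{𝒩_𝒟} Φ − Flux_K ≤ γ + ϑ + Cδ` along a monotone foliation of
`𝒩_𝒟 = ∂J⁺(C) ∖ C` from the shared sphere jet (`NullHypersurface.HasHawkingFlux`,
`hawkingFluxDensity_nonneg`, `IsDoublyConvex`/`IsConstantMassAspect`/`IsSPFoliation` of
`HawkingMassFlux.lean`; Sauter 2008 Thm 4.1, Roesch arXiv:1609.02875 Thms 1.1–1.2, Le arXiv:2404.17137;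
the frame of the limit is part of the proof, TRIAGE-r1-3 gap (1)); (ii) COERCIVITY of the cone flux at
Kerr's data modulo gauge and `(δM, δa)` — second variation of `M_B(u_C)` = T-canonical-energy flux of
linearised gravity through `𝒩 ⊂ {r ≥ 3M} ⊂ {T timelike}` (card F2; Prabhu–Wald arXiv:1807.09883 for
`a = 0`; the bet of the line for `a ≠ 0`); (iii) `J⁺(C) ∩ {r > M} ⊆ D⁺(C ∪ 𝒩_𝒟)` (global
hyperbolicity; TRIAGE-r1-2/3) and FINITE-TIME Cauchy(collar)–characteristic(cone) stability up to time
`T` (Rendall 1990; Luk arXiv:1107.0898; Hawking–Ellis §7.5), with `C^{k₁}` from the weighted-`L²`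
cone closeness by interpolation against the honest `C^{k'} ≤ Λ < 1` control of `J⁺(S) = D⁺(S)`
(Sketch-dead-c1 §2.3: `k' ≥ k₁ + 2`). No decay rate, no asymptotic stability, no Killing extension.
Given the floor (stub 3) this is "stability of the minimum"; it is FALSE if Kerr is a saddle of the
cut energy (then so is the crux: route KILL CRITERIA). Size: open problem (hardest stub). -/
theorem stub_conePinning : ∀ (χ m₀ R : ℝ), χ < 1 → 0 < m₀ → ∃ T : ℝ, ∀ (k₁ : ℕ) (ε₁ : ℝ≥0∞),
    0 < ε₁ → ∃ k' : ℕ, ∀ Λ : ℝ≥0∞, Λ < 1 → ∃ (δ : ℝ≥0∞) (γ ϑ : ℝ), 0 < δ ∧ 0 < γ ∧ 0 < ϑ ∧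
    ∀ (X : Type) [TopologicalSpace X] [ChartedSpace E3 X] [IsManifold (𝓡 3) ∞ X]
      [T2Space X] [SecondCountableTopology X] [ConnectedSpace X],
    ∀ D ∈ admissibleVacuumData X, ∀ (𝒟 : VacuumCauchyDevelopment D)
      (M a : Fin 1 → ℝ) (S : Set 𝒟.carrier) (p : 𝒟.carrier) (mo' : Fin 1 → lorentzGroup × E4)
      (B' : Fin 1 → ModelBackground) (Φ : ∀ i, (B' i).domain → 𝒟.carrier),
    𝒟.IsMaximal → (∀ i, m₀ ≤ M i ∧ M i ≤ m₀⁻¹ ∧ |a i| ≤ χ * M i) →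
    𝒟.toCauchyDevelopment.IsNearKerrLeaf k' Λ 1 M a S →
    (∃ i, p ∈ Φ i '' (B' i).truncTimeSlab (3 * M i) 0) →
    (∀ i, B' i = starBackground (mo' i).1 (mo' i).2 (M i) (a i)
      (fun x => Kerr.radius (a i) (poincareInv (mo' i).1 (mo' i).2 x))) →
    (∀ i, ContMDiffOn 𝓘(ℝ, E4) (𝓡 4) ∞ (Φ i)
        {x | -1 < (B' i).time x.1 ∧ (B' i).time x.1 < 1 ∧ (B' i).radius x.1 < 3 * M i + 1} ∧
      IsOpenEmbedding ({x | -1 < (B' i).time x.1 ∧ (B' i).time x.1 < 1 ∧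
        (B' i).radius x.1 < 3 * M i + 1}.restrict (Φ i))) →
    (∀ i, 𝒟.toSpacetime.truncDeviationCk (B' i) (Φ i) k' (3 * M i) 0 ≤ δ) →
    (∀ i, Φ i '' (B' i).truncTimeSlab (3 * M i) 0 ⊆ S) →
    (∃ m : ℝ, 𝒟.toCauchyDevelopment.HasCutBondiMass
        ({p} ∪ ⋃ i, Φ i '' (B' i).truncTimeSlab (3 * M i) 0) m ∧ m ≤ M 0 + γ) →
    (∀ m : ℝ, 𝒟.toCauchyDevelopment.HasCutBondiMass
        ({p} ∪ ⋃ i, Φ i '' (B' i).truncTimeSlab (3 * M i) 0) m → M 0 - ϑ ≤ m) →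
    ∃ Ψ : (B' 0).domain → 𝒟.carrier,
      (∀ x ∈ (B' 0).truncTimeSlab (3 * M 0) 0, Ψ x = Φ 0 x) ∧
      ContMDiffOn 𝓘(ℝ, E4) (𝓡 4) ∞ Ψ
        {x | -1 < (B' 0).time x.1 ∧ (B' 0).time x.1 < T + 1 ∧ (B' 0).radius x.1 < R + 1} ∧
      IsOpenEmbedding ({x | -1 < (B' 0).time x.1 ∧ (B' 0).time x.1 < T + 1 ∧
        (B' 0).radius x.1 < R + 1}.restrict Ψ) ∧
      supCkENorm (Subtype.val '' {x : (B' 0).domain | -1 < (B' 0).time x.1 ∧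
          (B' 0).time x.1 < T + 1 ∧ (B' 0).radius x.1 ≤ R ∧
          Ψ x ∈ 𝒟.metric.causalFuture 𝒟.timeOrientation
            ({p} ∪ ⋃ i, Φ i '' (B' i).truncTimeSlab (3 * M i) 0)}) k₁
        (𝒟.toSpacetime.deviationExtend (B' 0) Ψ) ≤ ε₁ ∧
      Ψ '' {x | T - 1 < (B' 0).time x.1 ∧ (B' 0).time x.1 < T + 1 ∧ (B' 0).radius x.1 < R + 1} ⊆
        𝒟.metric.causalFuture 𝒟.timeOrientation
          ({p} ∪ ⋃ i, Φ i '' (B' i).truncTimeSlab (3 * M i) 0) := by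
  sorry

/-- **Stub 5 — far-zone leaf completion (`N = 1`).** For `χ < 1`, `m₀ > 0` and a target `(k, ε)`
there is a near-zone radius `R` (`R ≳ M/ε`: Kerr is `ε`-flat beyond it) such that for every time
`T` there are a chart target `(k₁, ε₁)` and an order `k'` such that for every `Λ < 1` there are
`δ, γ > 0` with: if an MGHD of admissible data contains a `(Λ, k')`-leaf `S` with one windowed,
margined hole, a thick collar chart (`δ`, `C^{k'}`, slab `⊆ S`, probe point inside) whose core `C`
has an own cut energy `≤ M + γ`, AND a Kerr-star chart `Ψ` with the wedge properties of stub 4 at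
`(R, T, k₁, ε₁)`, then some `(ε, k)`-near-Kerr leaf `S'` with the same `(M, a)` lies in `J⁺(S)`.
`S'` = (hole chart: `Ψ` on the top layer, motion time-shifted by `T`) ∪ (flat hyperboloidal chart
beyond `ρ = R − 1`, asymptotic to a cut `u' > u_C`, inside `J⁺(C) ⊆ J⁺(S) = D⁺(S)`), plus the
overlap / upper-layer / barrier clauses of `IsNearKerrLeaf`. Why the far zone is `ε`-flat:
escaping radiation lies to the past of `S'`; outgoing radiation on `S'` is emitted from the wedge
(pinned); INCOMING content crossing `S'` crossed `𝒩_𝒟` far out and `S` before that, within affine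
distance `d* ≈ (u' − u_S)/2` independent of radius — its frequency is capped by `C^{k'} ≤ Λ < 1` on
`S` (only for `k' ≥ k + 2`), hence `ε`-visibility costs energy `≥ e_min(ε, k, d*) > 0`, while its
energy is `≤ γ + Cδ + C ε₁·poly(R)`: `M_B(u_C) = m_H(Σ) + ∫_{𝒩_𝒟} Φ ≤ M + γ` with the near cone read
off the wedge (Kerr's FAR cone is determined by the data at radius `R`, so Kerr's own far-shear tail
`~ 1/R` is subtracted exactly — this is why the hand-over is the wedge and the ORIGINAL core's energy,
not the cut energy of a later, bigger core). `(k₁, ε₁)` are chosen after `(R, T)` so that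
`ε₁ · poly(R) ≪ e_min`. Semi-global hyperboloidal analysis with loss of derivatives near `𝓘⁺`;
nearest print: CK 1993 / hyperboloidal stability, Bondi mass loss over `HasCutBondiMass`
(`CutBondiMass.lean`, printed only for CK/Bondi–Sachs spacetimes). Size: open problem / XL. -/
theorem stub_farLeafCompletion : ∀ (χ m₀ : ℝ) (k : ℕ) (ε : ℝ≥0∞), χ < 1 → 0 < m₀ → 0 < ε →
    ∃ R : ℝ, ∀ T : ℝ, ∃ (k₁ : ℕ) (ε₁ : ℝ≥0∞), 0 < ε₁ ∧ ∃ k' : ℕ, ∀ Λ : ℝ≥0∞, Λ < 1 →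
    ∃ (δ : ℝ≥0∞) (γ : ℝ), 0 < δ ∧ 0 < γ ∧
    ∀ (X : Type) [TopologicalSpace X] [ChartedSpace E3 X] [IsManifold (𝓡 3) ∞ X]
      [T2Space X] [SecondCountableTopology X] [ConnectedSpace X],
    ∀ D ∈ admissibleVacuumData X, ∀ (𝒟 : VacuumCauchyDevelopment D)
      (M a : Fin 1 → ℝ) (S : Set 𝒟.carrier) (p : 𝒟.carrier) (mo' : Fin 1 → lorentzGroup × E4)
      (B' : Fin 1 → ModelBackground) (Φ : ∀ i, (B' i).domain → 𝒟.carrier),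
    𝒟.IsMaximal → (∀ i, m₀ ≤ M i ∧ M i ≤ m₀⁻¹ ∧ |a i| ≤ χ * M i) →
    𝒟.toCauchyDevelopment.IsNearKerrLeaf k' Λ 1 M a S →
    (∃ i, p ∈ Φ i '' (B' i).truncTimeSlab (3 * M i) 0) →
    (∀ i, B' i = starBackground (mo' i).1 (mo' i).2 (M i) (a i)
      (fun x => Kerr.radius (a i) (poincareInv (mo' i).1 (mo' i).2 x))) →
    (∀ i, ContMDiffOn 𝓘(ℝ, E4) (𝓡 4) ∞ (Φ i)
        {x | -1 < (B' i).time x.1 ∧ (B' i).time x.1 < 1 ∧ (B' i).radius x.1 < 3 * M i + 1} ∧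
      IsOpenEmbedding ({x | -1 < (B' i).time x.1 ∧ (B' i).time x.1 < 1 ∧
        (B' i).radius x.1 < 3 * M i + 1}.restrict (Φ i))) →
    (∀ i, 𝒟.toSpacetime.truncDeviationCk (B' i) (Φ i) k' (3 * M i) 0 ≤ δ) →
    (∀ i, Φ i '' (B' i).truncTimeSlab (3 * M i) 0 ⊆ S) →
    (∃ m : ℝ, 𝒟.toCauchyDevelopment.HasCutBondiMass
        ({p} ∪ ⋃ i, Φ i '' (B' i).truncTimeSlab (3 * M i) 0) m ∧ m ≤ M 0 + γ) →
    ∀ Ψ : (B' 0).domain → 𝒟.carrier,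
      ((∀ x ∈ (B' 0).truncTimeSlab (3 * M 0) 0, Ψ x = Φ 0 x) ∧
        ContMDiffOn 𝓘(ℝ, E4) (𝓡 4) ∞ Ψ
          {x | -1 < (B' 0).time x.1 ∧ (B' 0).time x.1 < T + 1 ∧ (B' 0).radius x.1 < R + 1} ∧
        IsOpenEmbedding ({x | -1 < (B' 0).time x.1 ∧ (B' 0).time x.1 < T + 1 ∧
          (B' 0).radius x.1 < R + 1}.restrict Ψ) ∧
        supCkENorm (Subtype.val '' {x : (B' 0).domain | -1 < (B' 0).time x.1 ∧
            (B' 0).time x.1 < T + 1 ∧ (B' 0).radius x.1 ≤ R ∧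
            Ψ x ∈ 𝒟.metric.causalFuture 𝒟.timeOrientation
              ({p} ∪ ⋃ i, Φ i '' (B' i).truncTimeSlab (3 * M i) 0)}) k₁
          (𝒟.toSpacetime.deviationExtend (B' 0) Ψ) ≤ ε₁ ∧
        Ψ '' {x | T - 1 < (B' 0).time x.1 ∧ (B' 0).time x.1 < T + 1 ∧ (B' 0).radius x.1 < R + 1} ⊆
          𝒟.metric.causalFuture 𝒟.timeOrientation
            ({p} ∪ ⋃ i, Φ i '' (B' i).truncTimeSlab (3 * M i) 0)) →
      ∃ S' : Set 𝒟.carrier, 𝒟.toCauchyDevelopment.IsNearKerrLeaf k ε 1 M a S' ∧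
        S' ⊆ 𝒟.metric.causalFuture 𝒟.timeOrientation S := by
  sorry

/-- **Stub 6 — probe-cone stability (the `N = 0` engine), over HONEST leaves (`Λ < 1`).** For a
target `(k, ε)` there is `k'` such that for every `Λ < 1` there is `γ > 0` with: in an MGHD of
admissible data, a point `p` of a `(Λ, k')`-leaf `S` without holes whose cone cut has an own Bondi
energy `≤ γ` is followed by an `(ε, k)`-near-Minkowski leaf in `J⁺(S)` — a unit hyperboloid placed
inside `J⁺(p)` at hyperboloidal time `~ 2`, where radiation escaping before `u_p` is provably absent
and incoming content is priced by `γ` (energy) and `Λ` (frequency, `k' ≥ k + 2`): the semi-global,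
loss-of-derivatives light-cone / hyperboloidal positive-mass STABILITY statement (Sketch-dead-c1 §7;
cards hyperboloidal-mass-pinches-flat B2 = core-cone K5 = line Sketch `stub_lightConeRigidity`, all
REBASED here on `Λ < 1` as the triage demanded — with `∀ Λ < ⊤` it is false at `Λ = 2`, swarm W2).
Nearest print: vacuum hyperboloidal/spacetime-harmonic mass identities (arXiv:2002.01534,
arXiv:2102.11421), Dong–Song positive-mass stability, CK/LR small-data theory (all weighted — the
gap is unweighted-`Cᵏ` versus energy). Size: open problem. -/
theorem stub_probeConeStability : ∀ (k : ℕ) (ε : ℝ≥0∞), 0 < ε → ∃ k' : ℕ, ∀ Λ : ℝ≥0∞, Λ < 1 →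
    ∃ γ : ℝ, 0 < γ ∧
    ∀ (X : Type) [TopologicalSpace X] [ChartedSpace E3 X] [IsManifold (𝓡 3) ∞ X]
      [T2Space X] [SecondCountableTopology X] [ConnectedSpace X],
    ∀ D ∈ admissibleVacuumData X, ∀ (𝒟 : VacuumCauchyDevelopment D) (M a : Fin 0 → ℝ)
      (S : Set 𝒟.carrier) (p : 𝒟.carrier),
    𝒟.IsMaximal → 𝒟.toCauchyDevelopment.IsNearKerrLeaf k' Λ 0 M a S → p ∈ S →
    (∃ m : ℝ, 𝒟.toCauchyDevelopment.HasCutBondiMass {p} m ∧ m ≤ γ) →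
    ∃ S' : Set 𝒟.carrier, 𝒟.toCauchyDevelopment.IsNearKerrLeaf k ε 0 M a S' ∧
      S' ⊆ 𝒟.metric.causalFuture 𝒟.timeOrientation S := by
  sorry

/-! ## §2 Compositions

Three kernel-checked compositions (pure logic, sorry-free outside the stubs they invoke):

* `collarSectorGap_of_stubs` — the `N = 1` sector of C′ in GAP form from stubs 2–5; its statement is
  VERBATIM the foreign stub `stub_collarSectorGap` of line `hyperboloidal-mass-pinches-flat`
  (`Lines/hyperboloidal_mass_pinches_flat.lean`), so that line's lead can discharge its foreign sorry by
  this line's four collared stubs (INTERLOCK, direction 1);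
* `probeConeStability_of_hyperboloidalLine` — stub 6 of this line follows from that line's two `N = 0`
  stubs F3 (`stub_escapeWindowLeaf`) and B2 (`stub_hyperboloidalMassPinchesFlat`), statements copied
  verbatim as hypotheses, glued by `J⁺(J⁺{p}) = J⁺{p}` (`causalFuture_causalFuture_eq`) (INTERLOCK,
  direction 2: a lead may serve this line's `N = 0` sector by that line's engine);
* `BondiBartnikRigidityRepaired_of` — the target C′: trivial regime (landed p103152) ∪ probe sector
  (stubs 1 + 6) ∪ collar sector (`collarSectorGap_of_stubs`). -/

/-- **INTERLOCK 1 — the collar sector of C′ in gap form, from stubs 2–5.** Statement verbatim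
`stub_collarSectorGap` of `Lines/hyperboloidal_mass_pinches_flat.lean`: below the honesty threshold and
above the trivial regime (`ε < Λ < 1`), a `(Λ, k')`-leaf through ONE `δ`-Kerr thick collar containing
`p`, whose core has a cut energy and Bondi–Bartnik gap `≤ γ`, is followed by an `(ε, k)`-near-Kerr leaf
with the same `(M, a)` in `J⁺(S)`. Proof: the Kerr-capped competitor (stub 2, tolerance `γ⋆/3`) turns
the gap into the budget "own energy `≤ M + γ⋆`", the floor (stub 3) pins all energies `≥ M − ϑ`, cone
pinning (stub 4) returns the wedge chart, far completion (stub 5) the leaf; `k'` = max of the four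
orders, `δ` = min of the four tolerances. -/
theorem collarSectorGap_of_stubs : ∀ (χ m₀ : ℝ) (k : ℕ) (ε : ℝ≥0∞), χ < 1 → 0 < m₀ → 0 < ε →
    ∃ k' : ℕ, ∀ Λ : ℝ≥0∞, Λ < 1 → ε < Λ → ∃ (δ : ℝ≥0∞) (γ : ℝ), 0 < δ ∧ 0 < γ ∧
    ∀ (X : Type) [TopologicalSpace X] [ChartedSpace E3 X] [IsManifold (𝓡 3) ∞ X]
      [T2Space X] [SecondCountableTopology X] [ConnectedSpace X],
    ∀ D ∈ admissibleVacuumData X, ∀ (𝒟 : VacuumCauchyDevelopment D)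
      (M a : Fin 1 → ℝ) (S : Set 𝒟.carrier) (p : 𝒟.carrier) (mo' : Fin 1 → lorentzGroup × E4)
      (B' : Fin 1 → ModelBackground) (Φ : ∀ i, (B' i).domain → 𝒟.carrier),
    𝒟.IsMaximal → (∀ i, m₀ ≤ M i ∧ M i ≤ m₀⁻¹ ∧ |a i| ≤ χ * M i) →
    𝒟.toCauchyDevelopment.IsNearKerrLeaf k' Λ 1 M a S → p ∈ S →
    (∃ i, p ∈ Φ i '' (B' i).truncTimeSlab (3 * M i) 0) →
    (∀ i, B' i = starBackground (mo' i).1 (mo' i).2 (M i) (a i)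
      (fun x => Kerr.radius (a i) (poincareInv (mo' i).1 (mo' i).2 x))) →
    (∀ i, ContMDiffOn 𝓘(ℝ, E4) (𝓡 4) ∞ (Φ i)
        {x | -1 < (B' i).time x.1 ∧ (B' i).time x.1 < 1 ∧ (B' i).radius x.1 < 3 * M i + 1} ∧
      Topology.IsOpenEmbedding ({x | -1 < (B' i).time x.1 ∧ (B' i).time x.1 < 1 ∧
        (B' i).radius x.1 < 3 * M i + 1}.restrict (Φ i))) →
    (∀ i, 𝒟.toSpacetime.truncDeviationCk (B' i) (Φ i) k' (3 * M i) 0 ≤ δ) →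
    (∀ i, Φ i '' (B' i).truncTimeSlab (3 * M i) 0 ⊆ S) →
    (∃ m : ℝ, 𝒟.toCauchyDevelopment.HasCutBondiMass
      ({p} ∪ ⋃ i, Φ i '' (B' i).truncTimeSlab (3 * M i) 0) m) →
    𝒟.BondiBartnikGapLE ({p} ∪ ⋃ i, Φ i '' (B' i).truncTimeSlab (3 * M i) 0) γ →
    ∃ S' : Set 𝒟.carrier, 𝒟.toCauchyDevelopment.IsNearKerrLeaf k ε 1 M a S' ∧
      S' ⊆ 𝒟.metric.causalFuture 𝒟.timeOrientation S := by
  intro χ m₀ k ε hχ hm₀ hε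
  obtain ⟨R, hFar⟩ := stub_farLeafCompletion χ m₀ k ε hχ hm₀ hε
  obtain ⟨T, hNear⟩ := stub_conePinning χ m₀ R hχ hm₀
  obtain ⟨k₁, ε₁, hε₁, kF, hFar'⟩ := hFar T
  obtain ⟨kN, hNear'⟩ := hNear k₁ ε₁ hε₁
  obtain ⟨k₂, hC⟩ := stub_kerrCappedCompetitor χ m₀ hχ hm₀
  obtain ⟨k₃, hF⟩ := stub_kerrCollarFloor χ m₀ hχ hm₀
  set k' : ℕ := max (max kF kN) (max k₂ k₃) with hk'
  have hkF : kF ≤ k' := by omega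
  have hkN : kN ≤ k' := by omega
  have hk₂ : k₂ ≤ k' := by omega
  have hk₃ : k₃ ≤ k' := by omega
  refine ⟨k', fun Λ hΛ _hεΛ => ?_⟩
  obtain ⟨δF, γF, hδF, hγF, hFar''⟩ := hFar' Λ hΛ
  obtain ⟨δN, γN, ϑ, hδN, hγN, hϑ, hNear''⟩ := hNear' Λ hΛ
  obtain ⟨δ₃, hδ₃, hF'⟩ := hF ϑ hϑ
  set γs : ℝ := min γF γN with hγs
  have hγs0 : 0 < γs := lt_min hγF hγN
  have hγsF : γs ≤ γF := min_le_left _ _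
  have hγsN : γs ≤ γN := min_le_right _ _
  obtain ⟨δ₂, hδ₂, hC'⟩ := hC (γs / 3) (by positivity)
  set δ : ℝ≥0∞ := min (min δF δN) (min δ₂ δ₃) with hδ
  have hδ0 : 0 < δ := lt_min (lt_min hδF hδN) (lt_min hδ₂ hδ₃)
  have hδδF : δ ≤ δF := (min_le_left _ _).trans (min_le_left _ _)
  have hδδN : δ ≤ δN := (min_le_left _ _).trans (min_le_right _ _)
  have hδδ₂ : δ ≤ δ₂ := (min_le_right _ _).trans (min_le_left _ _)
  have hδδ₃ : δ ≤ δ₃ := (min_le_right _ _).trans (min_le_right _ _)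
  refine ⟨δ, γs / 3, hδ0, by positivity, ?_⟩
  intro X _ _ _ _ _ _ D hD 𝒟 M a S p mo' B' Φ hmax hwin hleaf _hp hpc hB hΦ hdev hsub hcut hgap
  -- monotonicity of the collar closeness in the order and the tolerance
  have hdev_of : ∀ {kk : ℕ} {dd : ℝ≥0∞}, kk ≤ k' → δ ≤ dd →
      ∀ i, 𝒟.toSpacetime.truncDeviationCk (B' i) (Φ i) kk (3 * M i) 0 ≤ dd := by
    intro kk dd hkk hdd i
    exact ((supCkENorm_mono_right _ hkk _).trans (hdev i)).trans hdd
  -- ONE instantiation of the competitor clause: the budget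
  obtain ⟨m', hm', hm'le⟩ := hC' X D hD 𝒟 M a p mo' B' Φ hmax hwin hpc hB hΦ (hdev_of hk₂ hδδ₂)
  obtain ⟨m, hm, hmle⟩ :=
    (VacuumCauchyDevelopment.bondiBartnikGapLE_iff.1 hgap) m' hm' (γs / 3) (by positivity)
  have hbudget : m ≤ M 0 + γs := by linarith
  -- the floor
  have hfloor : ∀ m : ℝ, 𝒟.toCauchyDevelopment.HasCutBondiMass
      ({p} ∪ ⋃ i, Φ i '' (B' i).truncTimeSlab (3 * M i) 0) m → M 0 - ϑ ≤ m :=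
    hF' X D hD 𝒟 M a p mo' B' Φ hmax hwin hpc hB hΦ (hdev_of hk₃ hδδ₃)
  -- cone pinning, then far-zone completion
  obtain ⟨Ψ, hΨ⟩ := hNear'' X D hD 𝒟 M a S p mo' B' Φ hmax hwin (hleaf.mono hkN le_rfl) hpc hB hΦ
    (hdev_of hkN hδδN) hsub ⟨m, hm, by linarith⟩ hfloor
  exact hFar'' X D hD 𝒟 M a S p mo' B' Φ hmax hwin (hleaf.mono hkF le_rfl) hpc hB hΦ
    (hdev_of hkF hδδF) hsub ⟨m, hm, by linarith⟩ Ψ hΨ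

/-- **INTERLOCK 2 — stub 6 from the hyperboloidal line's `N = 0` engine.** With F3 (`stub_escapeWindowLeaf`:
an honest leaf `S₁` INSIDE `J⁺(p)`) and B2 (`stub_hyperboloidalMassPinchesFlat`: small cut energy pinches
an honest hyperboloid inside `J⁺(p)` flat) of `Lines/hyperboloidal_mass_pinches_flat.lean` — statements
copied verbatim as hypotheses — the statement of `stub_probeConeStability` follows:
`S' ⊆ J⁺(S₁) ⊆ J⁺(J⁺{p}) = J⁺{p} ⊆ J⁺(S)`. So a lead building the merged line may serve this line's
`N = 0` sector with that line's two stubs. -/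
theorem probeConeStability_of_hyperboloidalLine
    (hF3 : ∀ (k₁ : ℕ), ∃ k' : ℕ, ∀ Λ : ℝ≥0∞, Λ < 1 →
      ∃ (Λ₁ : ℝ≥0∞) (γ : ℝ), Λ₁ < 1 ∧ 0 < γ ∧
      ∀ (X : Type) [TopologicalSpace X] [ChartedSpace E3 X] [IsManifold (𝓡 3) ∞ X]
        [T2Space X] [SecondCountableTopology X] [ConnectedSpace X],
      ∀ D ∈ admissibleVacuumData X, ∀ (𝒟 : VacuumCauchyDevelopment D) (M a : Fin 0 → ℝ)
        (S : Set 𝒟.carrier) (p : 𝒟.carrier) (m : ℝ),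
      𝒟.IsMaximal → 𝒟.toCauchyDevelopment.IsNearKerrLeaf k' Λ 0 M a S → p ∈ S →
      𝒟.toCauchyDevelopment.HasCutBondiMass ({p} : Set 𝒟.carrier) m → m ≤ γ →
      ∃ S₁ : Set 𝒟.carrier, 𝒟.toCauchyDevelopment.IsNearKerrLeaf k₁ Λ₁ 0 M a S₁ ∧
        S₁ ⊆ 𝒟.metric.causalFuture 𝒟.timeOrientation ({p} : Set 𝒟.carrier))
    (hB2 : ∀ (k : ℕ) (ε : ℝ≥0∞), 0 < ε → ∃ k₁ : ℕ,
      ∀ Λ₁ : ℝ≥0∞, Λ₁ < 1 → ∃ γ : ℝ, 0 < γ ∧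
      ∀ (X : Type) [TopologicalSpace X] [ChartedSpace E3 X] [IsManifold (𝓡 3) ∞ X]
        [T2Space X] [SecondCountableTopology X] [ConnectedSpace X],
      ∀ D ∈ admissibleVacuumData X, ∀ (𝒟 : VacuumCauchyDevelopment D) (M a : Fin 0 → ℝ)
        (S₁ : Set 𝒟.carrier) (p : 𝒟.carrier) (m : ℝ),
      𝒟.IsMaximal → 𝒟.toCauchyDevelopment.IsNearKerrLeaf k₁ Λ₁ 0 M a S₁ →
      S₁ ⊆ 𝒟.metric.causalFuture 𝒟.timeOrientation ({p} : Set 𝒟.carrier) →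
      𝒟.toCauchyDevelopment.HasCutBondiMass ({p} : Set 𝒟.carrier) m → m ≤ γ →
      ∃ S' : Set 𝒟.carrier, 𝒟.toCauchyDevelopment.IsNearKerrLeaf k ε 0 M a S' ∧
        S' ⊆ 𝒟.metric.causalFuture 𝒟.timeOrientation S₁) :
    ∀ (k : ℕ) (ε : ℝ≥0∞), 0 < ε → ∃ k' : ℕ, ∀ Λ : ℝ≥0∞, Λ < 1 →
    ∃ γ : ℝ, 0 < γ ∧
    ∀ (X : Type) [TopologicalSpace X] [ChartedSpace E3 X] [IsManifold (𝓡 3) ∞ X]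
      [T2Space X] [SecondCountableTopology X] [ConnectedSpace X],
    ∀ D ∈ admissibleVacuumData X, ∀ (𝒟 : VacuumCauchyDevelopment D) (M a : Fin 0 → ℝ)
      (S : Set 𝒟.carrier) (p : 𝒟.carrier),
    𝒟.IsMaximal → 𝒟.toCauchyDevelopment.IsNearKerrLeaf k' Λ 0 M a S → p ∈ S →
    (∃ m : ℝ, 𝒟.toCauchyDevelopment.HasCutBondiMass {p} m ∧ m ≤ γ) →
    ∃ S' : Set 𝒟.carrier, 𝒟.toCauchyDevelopment.IsNearKerrLeaf k ε 0 M a S' ∧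
      S' ⊆ 𝒟.metric.causalFuture 𝒟.timeOrientation S := by
  intro k ε hε
  obtain ⟨k₁, hP⟩ := hB2 k ε hε
  obtain ⟨k', hW⟩ := hF3 k₁
  refine ⟨k', fun Λ hΛ => ?_⟩
  obtain ⟨Λ₁, γ₄, hΛ₁, hγ₄, hW'⟩ := hW Λ hΛ
  obtain ⟨γ₅, hγ₅, hP'⟩ := hP Λ₁ hΛ₁
  refine ⟨min γ₄ γ₅, lt_min hγ₄ hγ₅, ?_⟩
  intro X _ _ _ _ _ _ D hD 𝒟 M a S p hmax hleaf hp hm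
  obtain ⟨m, hm, hmle⟩ := hm
  obtain ⟨S₁, hS₁, hS₁p⟩ := hW' X D hD 𝒟 M a S p m hmax hleaf hp hm (hmle.trans (min_le_left _ _))
  obtain ⟨S', hS', hS'S₁⟩ := hP' X D hD 𝒟 M a S₁ p m hmax hS₁ hS₁p hm (hmle.trans (min_le_right _ _))
  refine ⟨S', hS', hS'S₁.trans ((LorentzianMetric.causalFuture_mono hS₁p).trans ?_)⟩
  rw [LorentzianMetric.causalFuture_causalFuture_eq (WithTop.coe_le_coe.mpr le_top)
    ({p} : Set 𝒟.carrier)]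
  exact LorentzianMetric.causalFuture_mono (singleton_subset_iff.2 hp)

/-- **The line closes the repaired crux C′.** `BondiBartnikRigidityRepaired` by pure logic from: the
landed trivial regime (`Λ ≤ ε`, `Theorems.stub_trivialRegime`, p103152); the probe sector `N = 0` —
the small-ball competitor (stub 1, `p ∈ J⁺(ι X)` by `IsNearKerrLeaf.subset_causalFuture`) instantiates
the gap clause ONCE, the own energy of `{p}` is `≤ γ⋆`, and stub 6 gives the leaf; and the collar
sector `N = 1` — `collarSectorGap_of_stubs` (stubs 2–5) applied to the gap clause (`BondiBartnikGapLE`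
is definitionally the inlined competitor clause, `.mono` in `γ`); `N ≥ 2` is excluded by C′. -/
theorem BondiBartnikRigidityRepaired_of : BondiBartnikRigidityRepaired := by
  intro χ m₀ N₀ k ε hχ hm₀ hε
  obtain ⟨k₀, hP⟩ := stub_probeConeStability k ε hε
  obtain ⟨kc, hCol⟩ := collarSectorGap_of_stubs χ m₀ k ε hχ hm₀ hε
  set k' : ℕ := max k (max k₀ kc) with hk'
  have hkk' : k ≤ k' := by omega
  have hk₀ : k₀ ≤ k' := by omega
  have hkc : kc ≤ k' := by omega
  refine ⟨k', fun Λ hΛ => ?_⟩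
  by_cases hΛε : Λ ≤ ε
  · -- trivial regime: the hypothesis leaf itself (landed p103152)
    refine ⟨1, 1, one_pos, one_pos, ?_⟩
    intro X _ _ _ _ _ _ D hD 𝒟 N M a S p mo' B' Φ hmax hN hN1 hwin hleaf hp hpc hB hΦ hdev hsub hdis
      hcut hgap
    exact Summit.FinalStateConjecture.FinalStateConjecture.Theorems.stub_trivialRegime k k' ε Λ hkk'
      hΛε X D 𝒟 N M a S hleaf
  · -- the regime with content: ε < Λ < 1
    have hεΛ : ε < Λ := lt_of_not_ge hΛε
    obtain ⟨γ₀, hγ₀, hP'⟩ := hP Λ hΛ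
    obtain ⟨δc, γc, hδc, hγc, hCol'⟩ := hCol Λ hΛ hεΛ
    set γs : ℝ := min γ₀ γc with hγs
    have hγs0 : 0 < γs := lt_min hγ₀ hγc
    have hγs₀ : γs ≤ γ₀ := min_le_left _ _
    have hγsc : γs ≤ γc := min_le_right _ _
    refine ⟨δc, γs / 3, hδc, by positivity, ?_⟩
    intro X _ _ _ _ _ _ D hD 𝒟 N M a S p mo' B' Φ hmax hN hN1 hwin hleaf hp hpc hB hΦ hdev hsub hdis
      hcut hgap
    -- the gap clause in its definitional form
    have hgap' : 𝒟.BondiBartnikGapLE ({p} ∪ ⋃ i, Φ i '' (B' i).truncTimeSlab (3 * M i) 0)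
        (γs / 3) := hgap
    rcases N with _ | _ | n
    · -- N = 0: the core is the probe point
      have hC0 : ({p} ∪ ⋃ i, Φ i '' (B' i).truncTimeSlab (3 * M i) 0) = ({p} : Set 𝒟.carrier) := by
        simp
      rw [hC0] at hgap'
      obtain ⟨m', hm', hm'le⟩ := stub_probeBartnikMassZero X D hD 𝒟 p hmax
        (hleaf.subset_causalFuture hp) (γs / 3) (by positivity)
      obtain ⟨m, hm, hmle⟩ :=
        (VacuumCauchyDevelopment.bondiBartnikGapLE_iff.1 hgap') m' hm' (γs / 3) (by positivity)
      exact hP' X D hD 𝒟 M a S p hmax (hleaf.mono hk₀ le_rfl) hp ⟨m, hm, by linarith⟩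
    · -- N = 1: the collar sector (stubs 2–5)
      have hpc' : ∃ i, p ∈ Φ i '' (B' i).truncTimeSlab (3 * M i) 0 := by
        rcases hpc with h0 | h1
        · exact absurd h0 (Nat.succ_ne_zero 0)
        · exact h1
      exact hCol' X D hD 𝒟 M a S p mo' B' Φ hmax hwin (hleaf.mono hkc le_rfl) hp hpc' hB hΦ
        (fun i => (supCkENorm_mono_right _ hkc _).trans (hdev i)) hsub hcut
        (hgap'.mono (by linarith))
    · -- N ≥ 2 does not occur under C′
      exact absurd hN1 (by omega)

end Summit.FinalStateConjecture.FinalStateConjecture.Cruxes.BondiBartnikRigidity.TwoConesOneSphere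

end
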